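import Summits.QuantumFields.YangMills.Theorems.AllWindowsColdBoxBoxHighLineTiltParity
import Summits.QuantumFields.YangMills.Theorems.AllWindowsColdBoxBoxHighLineRestrictionCov
import Summits.QuantumFields.YangMills.Theorems.AllWindowsColdBoxBoxHighLinePlaqCostMomentsOnD

/-!
# T-S5.13K-R — RE-CENTRING the fourth (and second) moment at the tilted mean: `E_t[(G − E_tG)⁴] ≤ 16·E_t[(G − c)⁴]`, and its `t = 0` / `μ_D` forms for ANY tilt `U`
# (ASSEMBLY-S5 §6 (e4): the `E_0[Ẽ⁴]` slots of LEAD's ✓`Tilt.abs_tiltCum3_muD_zero_chartPlaqCost_le` are centred at the `μ_D`-mean, the sizes ✓13K-M/13K-G at the Gaussian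
# constant `a₁`; this file is the bridge.  LINE-19 S5 ⟨stmt-QuantumFields-24004⟩/⟨24335⟩)

Width seat `ym-line-sfw-p2-w4` (prover-ym-line-sfw-p2-w4-g28-0).

* at `t = 0` the tilt expectation does not depend on the tilt function (LEAD's ✓`Tilt.tiltExp_zero_indep`), so w5 g22's `L²(μ_t)` toolbox (stated for
  everywhere-bounded `U`) applies at `t = 0` to the UNBOUNDED `tiltU β H` by switching to `U′ = 0`;
* ★`Tilt.tiltExp_centred_pow_four_le` — for a finite `μ ≠ 0`, bounded measurable `U`, `G`, any `t`, any constant `c`: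
  `E_t[(G − E_tG)⁴] ≤ 16·E_t[(G − c)⁴]` (`(x−δ)⁴ ≤ 8x⁴ + 8δ⁴`, `δ = E_t[G − c]`, Jensen twice ✓`tiltExp_sq_le`: `δ⁴ ≤ (E_t[(G−c)²])² ≤ E_t[(G−c)⁴]`);
* `Tilt.tiltExp_zero_centredSq_le'` / `Tilt.tiltExp_zero_centred_pow_four_le` — the `t = 0` forms for ANY `U` (no bound on `U`);
* ★`Tilt.tiltExp_muD_zero_centred_pow_four_le` / `…centredSq_le` — the `μ_D` forms in `gaussAvg` letters:
  `E_0[(G − E_0G)⁴] ≤ 16·gaussAvg β H (sfInd H s · (G − c)⁴)/gaussAvg β H (sfInd H s)` (✓`Tilt.tiltExp_muD_zero_eq`), same with `2`/factor `1`;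
* ★★`Tilt.tiltExp_muD_zero_plaqCost_slots_le` — the E/O-slots of LEAD's ✓`abs_tiltCum3_muD_zero_chartPlaqCost_le` in its letters (`E = c − c^{odd}` at `(x,1,2)`,
  any tilt `U`, `1/2 ≤ gaussAvg(sfInd)`): `E_0[(E − E_0E)⁴] ≤ C(1+log H)⁴/β⁴`, `E_0[(E − E_0E)²] ≤ C(1+log H)²/β²`, `E_0[(c^{odd})⁴] ≤ C·s⁶/β³`
  (✓13K-M `TiltSup.gaussAvg_sfInd_even_sub_mean_moments_le` / `gaussAvg_sfInd_odd_pow_four_le`).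

Everything proved; no definitions; standard axioms.  HONEST LABEL: plumbing for the OPEN assembly T-S5.13 of the XL stub S5 of a critic-PASSed DRAFT line; S5, U5,
⟨24004⟩ ⟨24335⟩ ⟨24336⟩ remain OPEN; no crux, rung or summit is proved; the Yang–Mills mass gap is NOT proved by this file.
-/

set_option autoImplicit false

open MeasureTheory Set
open Literature.Probability.LatticeModels (Site)

namespace Summit.QuantumFields.YangMills.Theorems.AllWindowsColdBoxBoxHighLine

namespace Tilt

section Abstract

variable {Ω : Type*} [MeasurableSpace Ω] {μ : Measure Ω}

/-- ★ **Fourth moment re-centred at the tilted mean**: `E_t[(G − E_tG)⁴] ≤ 16·E_t[(G − c)⁴]` for every constant `c`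
(finite `μ ≠ 0`, bounded measurable `U`, `G`). -/
theorem tiltExp_centred_pow_four_le [IsFiniteMeasure μ] [NeZero μ] {U G : Ω → ℝ} {BU BG : ℝ} (hU : Measurable U) (hG : Measurable G)
    (hUb : ∀ x, |U x| ≤ BU) (hGb : ∀ x, |G x| ≤ BG) (t c : ℝ) :
    tiltExp μ U t (fun x => (G x - tiltExp μ U t G) ^ 4) ≤ 16 * tiltExp μ U t (fun x => (G x - c) ^ 4) := by
  set m := tiltExp μ U t G with hm
  set δ := m - c with hδ
  -- bounded measurable pieces
  have hGc : Measurable fun x => G x - c := hG.sub measurable_const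
  have hGcb : ∀ x, |G x - c| ≤ BG + |c| := fun x => (abs_sub _ _).trans (add_le_add (hGb x) le_rfl)
  have hGc2 : Measurable fun x => (G x - c) ^ 2 := hGc.pow_const 2
  have hGc2b : ∀ x, |(G x - c) ^ 2| ≤ (BG + |c|) ^ 2 := fun x => by
    rw [abs_pow]; exact pow_le_pow_left₀ (abs_nonneg _) (hGcb x) 2
  have hGc4 : Measurable fun x => (G x - c) ^ 4 := hGc.pow_const 4
  have hGc4b : ∀ x, |(G x - c) ^ 4| ≤ (BG + |c|) ^ 4 := fun x => by
    rw [abs_pow]; exact pow_le_pow_left₀ (abs_nonneg _) (hGcb x) 4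
  have hGm4 : Measurable fun x => (G x - m) ^ 4 := (hG.sub measurable_const).pow_const 4
  have hGm4b : ∀ x, |(G x - m) ^ 4| ≤ (BG + |m|) ^ 4 := fun x => by
    rw [abs_pow]; exact pow_le_pow_left₀ (abs_nonneg _) ((abs_sub _ _).trans (add_le_add (hGb x) le_rfl)) 4
  have hR : Measurable fun x => 8 * (G x - c) ^ 4 + 8 * δ ^ 4 := (hGc4.const_mul 8).add measurable_const
  have hRb : ∀ x, |8 * (G x - c) ^ 4 + 8 * δ ^ 4| ≤ 8 * (BG + |c|) ^ 4 + 8 * δ ^ 4 := fun x => by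
    rw [abs_of_nonneg (by positivity)]
    have := hGc4b x; rw [abs_of_nonneg (by positivity)] at this
    linarith
  -- pointwise `(G − m)⁴ = ((G − c) − δ)⁴ ≤ 8(G−c)⁴ + 8δ⁴`
  have hpt : ∀ x, (G x - m) ^ 4 ≤ 8 * (G x - c) ^ 4 + 8 * δ ^ 4 := by
    intro x
    have e : G x - m = (G x - c) - δ := by rw [hδ]; ring
    rw [e]
    nlinarith [sq_nonneg ((G x - c) ^ 2 - δ ^ 2), sq_nonneg ((G x - c) + δ), sq_nonneg ((G x - c) - δ),
      mul_nonneg (sq_nonneg ((G x - c) + δ)) (sq_nonneg ((G x - c) - δ))]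
  have hmono := tiltExp_mono (μ := μ) hGm4 hR hGm4b hRb U t hpt
  -- `E_t[8(G−c)⁴ + 8δ⁴] = 8E_t[(G−c)⁴] + 8δ⁴`
  have hsplit : tiltExp μ U t (fun x => 8 * (G x - c) ^ 4 + 8 * δ ^ 4) = 8 * tiltExp μ U t (fun x => (G x - c) ^ 4) + 8 * δ ^ 4 := by
    have h8 : Measurable fun x => 8 * (G x - c) ^ 4 := hGc4.const_mul 8
    have h8b : ∀ x, |8 * (G x - c) ^ 4| ≤ 8 * (BG + |c|) ^ 4 := fun x => by
      rw [abs_mul, abs_of_pos (by norm_num : (0:ℝ) < 8)]; exact mul_le_mul_of_nonneg_left (hGc4b x) (by norm_num)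
    rw [tiltExp_add (μ := μ) h8 measurable_const h8b (fun _ => le_rfl) U t, tiltExp_const_mul, tiltExp_const (μ := μ) hU hUb]
  -- `δ = E_t[G − c]`, Jensen twice
  have hδeq : δ = tiltExp μ U t (fun x => G x - c) := by rw [hδ, hm, tiltExp_sub_const (μ := μ) hU hG hUb hGb c t]
  have hJ1 : δ ^ 2 ≤ tiltExp μ U t (fun x => (G x - c) ^ 2) := by
    rw [hδeq]; exact tiltExp_sq_le (μ := μ) hU hGc hUb hGcb t
  have hJ2 : (tiltExp μ U t (fun x => (G x - c) ^ 2)) ^ 2 ≤ tiltExp μ U t (fun x => (G x - c) ^ 4) := by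
    have h := tiltExp_sq_le (μ := μ) hU hGc2 hUb hGc2b t
    have e : (fun x => ((G x - c) ^ 2) ^ 2) = fun x => (G x - c) ^ 4 := by funext x; ring
    rwa [e] at h
  have hδ4 : δ ^ 4 ≤ tiltExp μ U t (fun x => (G x - c) ^ 4) := by
    have h0 : 0 ≤ δ ^ 2 := sq_nonneg _
    calc δ ^ 4 = (δ ^ 2) ^ 2 := by ring
      _ ≤ (tiltExp μ U t (fun x => (G x - c) ^ 2)) ^ 2 := pow_le_pow_left₀ h0 hJ1 2
      _ ≤ _ := hJ2
  linarith

/-- `t = 0`, ANY tilt function: `E_0[(G − E_0G)²] ≤ E_0[(G − c)²]` (w5's ✓`tiltExp_centredSq_le` transported through `tiltExp_zero_indep`). -/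
theorem tiltExp_zero_centredSq_le' [IsFiniteMeasure μ] [NeZero μ] (U : Ω → ℝ) {G : Ω → ℝ} {BG : ℝ} (hG : Measurable G)
    (hGb : ∀ x, |G x| ≤ BG) (c : ℝ) :
    tiltExp μ U 0 (fun x => (G x - tiltExp μ U 0 G) ^ 2) ≤ tiltExp μ U 0 (fun x => (G x - c) ^ 2) := by
  -- at `t = 0` the tilt function is irrelevant (LEAD's ✓`Tilt.tiltExp_zero_indep`; inlined via ✓`tiltExp_zero` to keep the import light)
  have hz : ∀ G' : Ω → ℝ, tiltExp μ U 0 G' = tiltExp μ (fun _ => (0:ℝ)) 0 G' := fun G' => by rw [tiltExp_zero, tiltExp_zero]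
  rw [hz G, hz, hz]
  exact tiltExp_centredSq_le (μ := μ) measurable_const hG (fun _ => (abs_zero : |(0:ℝ)| = 0).le) hGb 0 c

/-- `t = 0`, ANY tilt function: `E_0[(G − E_0G)⁴] ≤ 16·E_0[(G − c)⁴]`. -/
theorem tiltExp_zero_centred_pow_four_le [IsFiniteMeasure μ] [NeZero μ] (U : Ω → ℝ) {G : Ω → ℝ} {BG : ℝ} (hG : Measurable G)
    (hGb : ∀ x, |G x| ≤ BG) (c : ℝ) :
    tiltExp μ U 0 (fun x => (G x - tiltExp μ U 0 G) ^ 4) ≤ 16 * tiltExp μ U 0 (fun x => (G x - c) ^ 4) := by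
  have hz : ∀ G' : Ω → ℝ, tiltExp μ U 0 G' = tiltExp μ (fun _ => (0:ℝ)) 0 G' := fun G' => by rw [tiltExp_zero, tiltExp_zero]
  rw [hz G, hz, hz]
  exact tiltExp_centred_pow_four_le (μ := μ) measurable_const hG (fun _ => (abs_zero : |(0:ℝ)| = 0).le) hGb 0 c

end Abstract

/-! ## The `μ_D` forms in `gaussAvg` letters -/

variable (H : ℕ)

/-- ★ **`E_0[(G − E_0G)⁴] ≤ 16 · gaussAvg β H (sfInd H s · (G − c)⁴) / gaussAvg β H (sfInd H s)`** on `μ_D`, for ANY tilt function `U`, any bounded measurable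
`G`, any constant `c` (`β > 0`, `0 < ∫ sfInd·gaussWeight`). -/
theorem tiltExp_muD_zero_centred_pow_four_le {β : ℝ} (hβ : 0 < β) {s : ℝ} (hD : 0 < ∫ a, sfInd H s a * gaussWeight β H a)
    (U : (LandauFree H → E3) → ℝ) {G : (LandauFree H → E3) → ℝ} {BG : ℝ} (hG : Measurable G) (hGb : ∀ a, |G a| ≤ BG) (c : ℝ) :
    tiltExp ((volume.restrict (smallField H s)).withDensity fun a => ENNReal.ofReal (gaussWeight β H a)) U 0
        (fun a => (G a - tiltExp ((volume.restrict (smallField H s)).withDensity fun a => ENNReal.ofReal (gaussWeight β H a)) U 0 G) ^ 4) ≤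
      16 * (gaussAvg β H (fun a => sfInd H s a * (G a - c) ^ 4) / gaussAvg β H (sfInd H s)) := by
  haveI := isFiniteMeasure_muD H hβ s
  haveI := neZero_muD H hβ hD
  rw [← tiltExp_muD_zero_eq H hβ s U (fun a => (G a - c) ^ 4)]
  exact tiltExp_zero_centred_pow_four_le _ hG hGb c

/-- **`E_0[(G − E_0G)²] ≤ gaussAvg β H (sfInd H s · (G − c)²) / gaussAvg β H (sfInd H s)`** on `μ_D`, for ANY tilt function `U`. -/
theorem tiltExp_muD_zero_centredSq_le {β : ℝ} (hβ : 0 < β) {s : ℝ} (hD : 0 < ∫ a, sfInd H s a * gaussWeight β H a)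
    (U : (LandauFree H → E3) → ℝ) {G : (LandauFree H → E3) → ℝ} {BG : ℝ} (hG : Measurable G) (hGb : ∀ a, |G a| ≤ BG) (c : ℝ) :
    tiltExp ((volume.restrict (smallField H s)).withDensity fun a => ENNReal.ofReal (gaussWeight β H a)) U 0
        (fun a => (G a - tiltExp ((volume.restrict (smallField H s)).withDensity fun a => ENNReal.ofReal (gaussWeight β H a)) U 0 G) ^ 2) ≤
      gaussAvg β H (fun a => sfInd H s a * (G a - c) ^ 2) / gaussAvg β H (sfInd H s) := by
  haveI := isFiniteMeasure_muD H hβ s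
  haveI := neZero_muD H hβ hD
  rw [← tiltExp_muD_zero_eq H hβ s U (fun a => (G a - c) ^ 2)]
  exact tiltExp_zero_centredSq_le' _ hG hGb c

/-- The plain (uncentred) `t = 0` moment on `μ_D` in `gaussAvg` letters, for ANY tilt function: `E_0[F] = gaussAvg(sfInd·F)/gaussAvg(sfInd)`
(restated pointer to ✓`tiltExp_muD_zero_eq` for the `E_0[O⁴]`, `E_0[U_o²]` slots, which need no re-centring). -/
example {β : ℝ} (hβ : 0 < β) (s : ℝ) (U F : (LandauFree H → E3) → ℝ) :
    tiltExp ((volume.restrict (smallField H s)).withDensity fun a => ENNReal.ofReal (gaussWeight β H a)) U 0 F =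
      gaussAvg β H (fun a => sfInd H s a * F a) / gaussAvg β H (sfInd H s) := tiltExp_muD_zero_eq H hβ s U F

/-- ★★ **The E/O-slots of LEAD's ✓`abs_tiltCum3_muD_zero_chartPlaqCost_le`, in its letters.**  For `H ≥ 1`, `β ≥ 1`, `0 < s ≤ 1`, any base point `x`,
`1/2 ≤ gaussAvg β H (sfInd H s)` and ANY tilt function `U`, with `E a = chartPlaqCost H x 1 2 a − chartPlaqCostOdd H x 1 2 a` and the literal `μ_D`:
`E_0[(E − E_0E)⁴] ≤ C(1+log H)⁴/β⁴`, `E_0[(E − E_0E)²] ≤ C(1+log H)²/β²`, `E_0[(c^{odd})⁴] ≤ C·s⁶/β³`. -/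
theorem tiltExp_muD_zero_plaqCost_slots_le : ∃ C : ℝ, 0 ≤ C ∧ ∀ H : ℕ, 1 ≤ H → ∀ β : ℝ, 1 ≤ β → ∀ s : ℝ, 0 < s → s ≤ 1 → ∀ x : Site 4,
    1 / 2 ≤ gaussAvg β H (sfInd H s) → ∀ U : (LandauFree H → E3) → ℝ,
      tiltExp ((volume.restrict (smallField H s)).withDensity fun a => ENNReal.ofReal (gaussWeight β H a)) U 0
          (fun a => (chartPlaqCost H x 1 2 a - chartPlaqCostOdd H x 1 2 a -
            tiltExp ((volume.restrict (smallField H s)).withDensity fun a => ENNReal.ofReal (gaussWeight β H a)) U 0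
              (fun a => chartPlaqCost H x 1 2 a - chartPlaqCostOdd H x 1 2 a)) ^ 4) ≤ C * (1 + Real.log H) ^ 4 / β ^ 4 ∧
      tiltExp ((volume.restrict (smallField H s)).withDensity fun a => ENNReal.ofReal (gaussWeight β H a)) U 0
          (fun a => (chartPlaqCost H x 1 2 a - chartPlaqCostOdd H x 1 2 a -
            tiltExp ((volume.restrict (smallField H s)).withDensity fun a => ENNReal.ofReal (gaussWeight β H a)) U 0
              (fun a => chartPlaqCost H x 1 2 a - chartPlaqCostOdd H x 1 2 a)) ^ 2) ≤ C * (1 + Real.log H) ^ 2 / β ^ 2 ∧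
      tiltExp ((volume.restrict (smallField H s)).withDensity fun a => ENNReal.ofReal (gaussWeight β H a)) U 0
          (fun a => chartPlaqCostOdd H x 1 2 a ^ 4) ≤ C * s ^ 6 / β ^ 3 := by
  obtain ⟨CM, hCM0, hM⟩ := TiltSup.gaussAvg_sfInd_even_sub_mean_moments_le
  obtain ⟨CO, hCO0, hO⟩ := TiltSup.gaussAvg_sfInd_odd_pow_four_le
  refine ⟨32 * CM + 2 * CO, by positivity, fun H hH β hβ s hs0 hs1 x hden U => ?_⟩
  have hβ0 : 0 < β := by linarith
  -- positivity of the restricted mass from `1/2 ≤ gaussAvg(sfInd)`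
  have hD : 0 < ∫ a, sfInd H s a * gaussWeight β H a := by
    have hZ := EdgeChartGaussian.integral_gaussWeight_pos H hβ0
    have h : 0 < gaussAvg β H (sfInd H s) := by linarith
    unfold gaussAvg at h
    by_contra hle
    push Not at hle
    have : (∫ a, sfInd H s a * gaussWeight β H a) / ∫ a, gaussWeight β H a ≤ 0 := div_nonpos_of_nonpos_of_nonneg hle hZ.le
    linarith
  -- `1/2 ≤ gaussAvg(sfInd)` turns a restricted ratio into twice its numerator (w5 g23's ✓`GaussNormalForm.div_le_two_mul_of_half_le`, inlined)
  have div_gaussAvg_sfInd_le_two_mul : ∀ {num : ℝ}, 0 ≤ num → num / gaussAvg β H (sfInd H s) ≤ 2 * num := by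
    intro num hnum
    have hden0 : 0 < gaussAvg β H (sfInd H s) := by linarith
    rw [div_le_iff₀ hden0]
    nlinarith
  set E : (LandauFree H → E3) → ℝ := fun a => chartPlaqCost H x 1 2 a - chartPlaqCostOdd H x 1 2 a with hE
  have hmE : Measurable E := (EdgeChartGaussian.measurable_chartPlaqCost H x 1 2).sub (EdgeChartGaussian.measurable_chartPlaqCostOdd H x 1 2)
  have hEb : ∀ a, |E a| ≤ 8 := fun a =>
    (abs_sub _ _).trans (by
      have h1 := Summit.QuantumFields.YangMills.Theorems.WeakCouplingRates.abs_plaqCostAt_le x 1 2 (edgeChart H a)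
      have h2 := EdgeChartGaussian.abs_chartPlaqCostOdd_le H x 1 2 a
      change |chartPlaqCost H x 1 2 a| ≤ 4 at h1
      linarith)
  set a₁ := gaussAvg β H (linCurvSq H (Summit.QuantumFields.YangMills.Theorems.WeakCouplingRates.plaq12At x)) with ha₁
  obtain ⟨h2m, h4m⟩ := hM H hH β hβ s hs0.le hs1 x
  have ho := hO H hH β hβ s hs0.le hs1 x
  have h4 := tiltExp_muD_zero_centred_pow_four_le H hβ0 hD U hmE hEb a₁
  have h2 := tiltExp_muD_zero_centredSq_le H hβ0 hD U hmE hEb a₁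
  have hnum4 : 0 ≤ gaussAvg β H (fun a => sfInd H s a * (E a - a₁) ^ 4) :=
    EdgeChartGaussian.gaussAvg_nonneg H hβ0 fun a => mul_nonneg (TiltSup.sfInd_nonneg_le_one s a).1 (by positivity)
  have hnum2 : 0 ≤ gaussAvg β H (fun a => sfInd H s a * (E a - a₁) ^ 2) :=
    EdgeChartGaussian.gaussAvg_nonneg H hβ0 fun a => mul_nonneg (TiltSup.sfInd_nonneg_le_one s a).1 (sq_nonneg _)
  have hnumO : 0 ≤ gaussAvg β H (fun a => sfInd H s a * chartPlaqCostOdd H x 1 2 a ^ 4) :=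
    EdgeChartGaussian.gaussAvg_nonneg H hβ0 fun a => mul_nonneg (TiltSup.sfInd_nonneg_le_one s a).1 (by positivity)
  have hE4 : ∀ a, sfInd H s a * (E a - a₁) ^ 4 = sfInd H s a * (chartPlaqCost H x 1 2 a - chartPlaqCostOdd H x 1 2 a - a₁) ^ 4 := fun a => rfl
  have hE2 : ∀ a, sfInd H s a * (E a - a₁) ^ 2 = sfInd H s a * (chartPlaqCost H x 1 2 a - chartPlaqCostOdd H x 1 2 a - a₁) ^ 2 := fun a => rfl
  refine ⟨?_, ?_, ?_⟩
  · refine h4.trans ?_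
    have hr := div_gaussAvg_sfInd_le_two_mul hnum4
    have h4m' : gaussAvg β H (fun a => sfInd H s a * (E a - a₁) ^ 4) ≤ CM * (1 + Real.log H) ^ 4 / β ^ 4 := h4m
    have h0 : 0 ≤ (1 + Real.log (H : ℝ)) ^ 4 / β ^ 4 := by
      have : (1 : ℝ) ≤ H := by exact_mod_cast hH
      have := Real.log_nonneg this
      positivity
    calc 16 * (gaussAvg β H (fun a => sfInd H s a * (E a - a₁) ^ 4) / gaussAvg β H (sfInd H s))
        ≤ 16 * (2 * (CM * (1 + Real.log H) ^ 4 / β ^ 4)) := by nlinarith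
      _ = 32 * CM * ((1 + Real.log H) ^ 4 / β ^ 4) := by ring
      _ ≤ (32 * CM + 2 * CO) * ((1 + Real.log H) ^ 4 / β ^ 4) := by nlinarith
      _ = _ := by ring
  · refine h2.trans ?_
    have hr := div_gaussAvg_sfInd_le_two_mul hnum2
    have h2m' : gaussAvg β H (fun a => sfInd H s a * (E a - a₁) ^ 2) ≤ CM * (1 + Real.log H) ^ 2 / β ^ 2 := h2m
    have h0 : 0 ≤ (1 + Real.log (H : ℝ)) ^ 2 / β ^ 2 := by positivity
    calc gaussAvg β H (fun a => sfInd H s a * (E a - a₁) ^ 2) / gaussAvg β H (sfInd H s)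
        ≤ 2 * (CM * (1 + Real.log H) ^ 2 / β ^ 2) := by nlinarith
      _ = 2 * CM * ((1 + Real.log H) ^ 2 / β ^ 2) := by ring
      _ ≤ (32 * CM + 2 * CO) * ((1 + Real.log H) ^ 2 / β ^ 2) := by nlinarith
      _ = _ := by ring
  · rw [tiltExp_muD_zero_eq H hβ0 s U]
    have hr := div_gaussAvg_sfInd_le_two_mul hnumO
    have h0 : 0 ≤ s ^ 6 / β ^ 3 := by positivity
    calc gaussAvg β H (fun a => sfInd H s a * chartPlaqCostOdd H x 1 2 a ^ 4) / gaussAvg β H (sfInd H s)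
        ≤ 2 * (CO * s ^ 6 / β ^ 3) := by nlinarith
      _ = 2 * CO * (s ^ 6 / β ^ 3) := by ring
      _ ≤ (32 * CM + 2 * CO) * (s ^ 6 / β ^ 3) := by nlinarith
      _ = _ := by ring

end Tilt

end Summit.QuantumFields.YangMills.Theorems.AllWindowsColdBoxBoxHighLine
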